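import Summits.QuantumFields.YangMills.Theorems.UnitScaleTiltProp7Lane2FamilyRowsShape
import Summits.QuantumFields.YangMills.Theorems.UnitScaleTiltProp7Lane2GridResourceRows
import Summits.QuantumFields.YangMills.Theorems.UnitScaleTiltProp7Lane2CutoffPackageGrid
import Summits.QuantumFields.YangMills.Theorems.UnitScaleTiltProp7QkcInnerPatchRows
import Summits.QuantumFields.YangMills.Theorems.UnitScaleTiltProp7EngOfTrueAvgBudget
import HarnessLib

/-!
# Prop. 7 on T³ — lane II [I-9] PATCHES2: the frozen patch schema `hPatch` (v2, floor `s₀`) FROM ONE DISPLAYED PER-PATCH SCHEMA `hP1`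

Route `UnitScaleTilt`, crux `MinimiserStabilityRegPr` (stmt-QuantumFields-19200), E′ growth side, lane II «divergence recovery at the curved regular member».
Cell `ym3-torus`, width seat `ym3-torus-px12` (gen 9) — the PATCHES2 assembler (★p1 g19 12:26:11Z desk note; px4 g9 13:08:32Z yield).  THE ASSEMBLY (body by name over the landed bricks).

`hP1` (CONSUMER-FIRST TARGET OF PATCHES1's `patch_rows`): for every `L > 1` the `s`-free coefficients `cL cMR cHM ≥ 0`, a floor `s₀`, and for every `s ≥ s₀` the ten
`s`-dependent coefficients and a radius `eP > 0`, such that at every member (`F.L = L`, `n < K`, `s < F.m + n`, `0 < e ≤ eP`, `RegPr F n K e W`), every one-form `y`,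
every grid point `g` (centre `c_g := corner g` of ✓`exists_cutoffPackage_grid`) and EVERY cutoff triple `(ζc, Z, ZE)` obeying the package's six per-centre rows at `c_g`
(values in `[0,1]`, support radius `L^s·ℓ`, steps, second differences, the two (Z2) readings), there are patch fields `φ κs r` and resource reals `N Cu As` with: the two
local equations `hloc`∕`hDφ` of `hPatch`; the SEVEN per-patch bounds in ✓`Prop7DivRecoveryAssemblyBudgetW4.patch_budget_v2`'s OUTPUT shapes on the CANONICAL letters
`Φ := ‖φ‖²`, `ρ := ‖r‖²`, `K := ‖Z κs‖²`, `L := ‖Δ_W(Z φ) − Z(Δ_W φ)‖²`, `M := ‖D_W(Z φ) − ZE(D_W φ)‖²`, `Hρ := H(ZE r)`, `HM := H(D_W(Z φ) − ZE(D_W φ))` (`H` = the door's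
local energy `c₀ℓ²·CURL_HS + ‖D*_W ·‖²`, written out); and THREE FEEDS bounding `N Cu As` by the data's local masses over px9's patches of block radius `2L^s + 2` about `g`
(bond ∕ site ∕ coarse-bond filter sets of ✓`Prop7Lane2GridResourceRows` VERBATIM, weights `c₀‖y b‖_F²`, `c₀ℓ²Σ_{μ<ν}hs(curl_W y x)`, `(c₀∕cB)ℓ³·cB·‖fibre(Qkc y) ĉ‖²`).
CONCLUSION: `hPatch` of `Prop7DivRecoveryPatchesToRowsV2.hRows_of_core_and_patches_v2` (= ✓p711865's :61–:90 with the floor `∃ s₀ … s₀ ≤ s →`) at `H :=` the door lambda.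

HONEST SCOPE.  Assembly bookkeeping; `hP1` is OPEN (PATCHES1, w1-19200 g16 ∕ p1 g20); nothing of (REC)∕hN06∕hcoS∕E′∕EX∕the crux is proved here; YM₃ on T³ is rung R3 —
NOT d = 4, NOT infinite volume, NOT a mass gap, NOT Clay.
[cite: Balaban1985BackgroundPropagators, (3.10) p.392, (3.19)-(3.26) pp.393-395, (3.100) pp.413-414]
-/

set_option autoImplicit false

noncomputable section

open scoped InnerProductSpace ComplexConjugate BigOperators Matrix.Norms.L2Operator

namespace Summit.QuantumFields.YangMills.Theorems.Prop7DivRecoveryAssemblyPatches2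

open Literature.MathematicalPhysics.QuantumFieldTheory.Balaban1983to89
open Literature.MathematicalPhysics.QuantumFieldTheory.Balaban1983to89.T3ContinuumYM3Torus
open T3PrintedRegularMinimiser (RegPr)
open B5Eq118OneStroke (iterBlockOf)
open B9TorusCalculus (torusT)
open B9Eq39Adjoint (curl divB)
open B10Eq27TorusAxialLog (unitsField toUField)
open B11Eq103H1Complex (SiteL2K BondL2K)
open Summit.QuantumFields.YangMills.Theorems.Prop7SectET3Transport (periodsT3)
open Summit.QuantumFields.YangMills.Theorems.Prop7SectET3HilbertLetters (W₂ frobEquiv toL2 toL2S DL2 DstarL2 covLapSite)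
open Summit.QuantumFields.YangMills.Theorems.Prop7SectET3WilsonHessian (DeltaEtaSlot)
open T3PrintedRegularOrbits (sites_eq)
open T3LevelShift (bondShift)
open B9Eq311L2Pairing (WL2)
open Summit.QuantumFields.YangMills.Theorems.Prop7SectET3CombLetters (Qkc)
open Summit.QuantumFields.YangMills.Theorems.Prop7Lane2CutoffPackageGrid (exists_cutoffPackage_grid)
open Summit.QuantumFields.YangMills.Theorems.Prop7Lane2PartitionOfUnityGrid (corner_injOn)
open Summit.QuantumFields.YangMills.Theorems.Prop7Lane2GridResourceRows (sum_le_729_mul_sum_of_patch_bonds sum_le_mul_sum_of_patch_sites sum_le_mul_sum_of_patch_coarseBonds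
  multiplicity_le_729)
open Summit.QuantumFields.YangMills.Theorems.Prop7Lane2OverlapRows (localEnergy_sum_le_of_overlap)
open Summit.QuantumFields.YangMills.Theorems.Prop7Lane2FamilyRowsShape (family_rows)
open Summit.QuantumFields.YangMills.Theorems.Prop7DivRecoveryCutoffReadings (norm_sq_siteCutoff_le_norm_sq norm_sq_bondCutoff_le_norm_sq)
open Summit.QuantumFields.YangMills.Theorems.Prop7QkcInnerPatchRows (sum_fibre_sq_le_norm_sq)
open Summit.QuantumFields.YangMills.Theorems.Prop7EngOfTrueAvgBudget (curlHS_le_re_inner_DeltaEtaSlot)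
open Summit.QuantumFields.YangMills.Theorems.Prop7DeltaEtaAlmostPositive (norm_toL2_sq)

variable (c₀ cB : ℕ → ℝ) [hc₀ : ∀ L : ℕ, Fact (0 < c₀ L)] [hcB : ∀ L : ℕ, Fact (0 < cB L)]

-- HEARTBEAT BUDGET (README rule, measured 2026-08-29 13:45Z): the statement alone is ≈ 100 lines with the door lambda written out four times; the assembly elaborates
-- in ≈ 10 s at the default budget but FAILS at a file-global 100k (`whnf` in the final anonymous constructor) — one line-neutral decl-local bump, never file-global.
set_option maxHeartbeats 400000 in
/-- ★★★ **PATCHES2** — `hPatch` (v2, floor `s₀`, `H :=` the door lambda) from the per-patch schema `hP1`.  [cite: Balaban1985BackgroundPropagators, (3.19)-(3.26) pp.393-395, (3.100) pp.413-414] -/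
theorem hPatch_of_patchRows
    (hP1 : ∀ (L : ℕ), 1 < L → ∃ cL cMR cHM : ℝ, 0 ≤ cL ∧ 0 ≤ cMR ∧ 0 ≤ cHM ∧ ∃ s₀ : ℕ, ∀ s : ℕ, s₀ ≤ s →
      ∃ cΦ cρCu cρN cKCu cKN cMAs cMCu cMe cHCu cHN eP : ℝ,
        0 ≤ cΦ ∧ 0 ≤ cρCu ∧ 0 ≤ cρN ∧ 0 ≤ cKCu ∧ 0 ≤ cKN ∧ 0 ≤ cMAs ∧ 0 ≤ cMCu ∧ 0 ≤ cMe ∧ 0 ≤ cHCu ∧ 0 ≤ cHN ∧ 0 < eP ∧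
        ∀ (F : T3Family), F.L = L → ∀ (n K : ℕ) (hnK : n < K) (e : ℝ) (W : GaugeField (F.P K) 0 (Matrix.specialUnitaryGroup (Fin 2) ℂ)),
          s < F.m + n → 0 < e → e ≤ eP → RegPr F n K e W →
          ∀ (y : BondL2K ℂ 3 (periodsT3 F K) (c₀ F.L) W₂),
          ∀ g ∈ (Fintype.piFinset fun _ : Fin 3 => Finset.range (2 * F.L ^ (F.m + n - s))),
          ∀ (ζc : Site (F.P K) 0 → ℝ) (Z : SiteL2K ℂ 3 (periodsT3 F K) (c₀ F.L) W₂ →ₗ[ℂ] SiteL2K ℂ 3 (periodsT3 F K) (c₀ F.L) W₂)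
            (ZE : BondL2K ℂ 3 (periodsT3 F K) (c₀ F.L) W₂ →ₗ[ℂ] BondL2K ℂ 3 (periodsT3 F K) (c₀ F.L) W₂),
            (∀ x, 0 ≤ ζc x ∧ ζc x ≤ 1) →
            (∀ x, ζc x ≠ 0 → ∀ κ : Fin 3, min (x κ - ((g κ * (F.L ^ s * F.L ^ (K - n)) : ℕ) : ZMod ((F.P K).sitesPerDir 0))).val (((g κ * (F.L ^ s * F.L ^ (K - n)) : ℕ) : ZMod ((F.P K).sitesPerDir 0)) - x κ).val < F.L ^ s * F.L ^ (K - n)) →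
            (∀ x (μ : Fin 3), |ζc (x.shift μ) - ζc x| ≤ 3 / 2 / ((F.L : ℝ) ^ s * (F.L : ℝ) ^ (K - n)) ∧ |ζc (x.unshift μ) - ζc x| ≤ 3 / 2 / ((F.L : ℝ) ^ s * (F.L : ℝ) ^ (K - n))) →
            (∀ x (μ : Fin 3), |ζc (x.shift μ) + ζc (x.unshift μ) - 2 * ζc x| ≤ 6 / ((F.L : ℝ) ^ s * (F.L : ℝ) ^ (K - n)) ^ 2) →
            (∀ φ x, (toL2S F K (c₀ F.L)).symm (Z φ) x = ζc x • (toL2S F K (c₀ F.L)).symm φ x) →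
            (∀ f b, (toL2 F K (c₀ F.L)).symm (ZE f) b = ζc b.src • (toL2 F K (c₀ F.L)).symm f b) →
            ∃ (φ κs : SiteL2K ℂ 3 (periodsT3 F K) (c₀ F.L) W₂) (r : BondL2K ℂ 3 (periodsT3 F K) (c₀ F.L) W₂) (N Cu As : ℝ),
              Z (DstarL2 F n K (c₀ F.L) W y) = Z (covLapSite F n K (c₀ F.L) W φ) + Z κs ∧
              ZE (DL2 F n K (c₀ F.L) W φ) = ZE y - ZE r ∧
              ‖φ‖ ^ 2 ≤ cΦ * ((F.L : ℝ) ^ s) ^ 2 * N ∧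
              ‖r‖ ^ 2 ≤ cρCu * Cu + cρN * e * N ∧
              ‖Z κs‖ ^ 2 ≤ cKCu * Cu + cKN * e * N ∧
              ‖covLapSite F n K (c₀ F.L) W (Z φ) - Z (covLapSite F n K (c₀ F.L) W φ)‖ ^ 2 ≤ cL * ((F.L : ℝ) ^ s)⁻¹ ^ 2 * N ∧
              ‖DL2 F n K (c₀ F.L) W (Z φ) - ZE (DL2 F n K (c₀ F.L) W φ)‖ ^ 2
                ≤ cMAs * As + cMCu * Cu + (cMR * ((F.L : ℝ) ^ s)⁻¹ ^ 2 + cMe * e) * N ∧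
              (c₀ F.L * ((F.L : ℝ) ^ (K - n)) ^ 2 * (∑ x : Site (F.P K) 0, ∑ μ : Fin (F.P K).d, ∑ ν : Fin (F.P K).d, (if μ < ν then ∑ j : Fin 2, ∑ k : Fin 2, ‖(curl (torusT (F.P K) 0) (fun κ z => unitsField (toUField W) ⟨z, κ⟩) (fun κ z => (toL2 F K (c₀ F.L)).symm (ZE r) ⟨z, κ⟩) μ ν x) j k‖ ^ 2 else 0)) + ‖DstarL2 F n K (c₀ F.L) W (ZE r)‖ ^ 2)
                ≤ cHCu * Cu + cHN * e * N ∧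
              (c₀ F.L * ((F.L : ℝ) ^ (K - n)) ^ 2 * (∑ x : Site (F.P K) 0, ∑ μ : Fin (F.P K).d, ∑ ν : Fin (F.P K).d, (if μ < ν then ∑ j : Fin 2, ∑ k : Fin 2, ‖(curl (torusT (F.P K) 0) (fun κ z => unitsField (toUField W) ⟨z, κ⟩) (fun κ z => (toL2 F K (c₀ F.L)).symm (DL2 F n K (c₀ F.L) W (Z φ) - ZE (DL2 F n K (c₀ F.L) W φ)) ⟨z, κ⟩) μ ν x) j k‖ ^ 2 else 0)) + ‖DstarL2 F n K (c₀ F.L) W (DL2 F n K (c₀ F.L) W (Z φ) - ZE (DL2 F n K (c₀ F.L) W φ))‖ ^ 2)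
                ≤ cHM * ((F.L : ℝ) ^ s)⁻¹ ^ 2 * N ∧
              N ≤ ∑ b ∈ Finset.univ.filter (fun b : PBond (F.P K) 0 => ∀ κ : Fin 3,
                  min ((iterBlockOf (K - n) b.src) κ - ((g κ * F.L ^ s : ℕ) : ZMod ((F.P K).sitesPerDir (K - n)))).val
                    ((((g κ * F.L ^ s : ℕ) : ZMod ((F.P K).sitesPerDir (K - n)))) - (iterBlockOf (K - n) b.src) κ).val ≤ 2 * F.L ^ s + 2), c₀ F.L * ‖(frobEquiv.symm ((toL2 F K (c₀ F.L)).symm y b) : W₂)‖ ^ 2 ∧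
              Cu ≤ ∑ x ∈ Finset.univ.filter (fun x : Site (F.P K) 0 => ∀ κ : Fin 3,
                  min ((iterBlockOf (K - n) x) κ - ((g κ * F.L ^ s : ℕ) : ZMod ((F.P K).sitesPerDir (K - n)))).val
                    ((((g κ * F.L ^ s : ℕ) : ZMod ((F.P K).sitesPerDir (K - n)))) - (iterBlockOf (K - n) x) κ).val ≤ 2 * F.L ^ s + 2),
                c₀ F.L * ((F.L : ℝ) ^ (K - n)) ^ 2 * ∑ μ : Fin (F.P K).d, ∑ ν : Fin (F.P K).d, (if μ < ν then ∑ j : Fin 2, ∑ k : Fin 2,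
                  ‖(curl (torusT (F.P K) 0) (fun κ z => unitsField (toUField W) ⟨z, κ⟩) (fun κ z => (toL2 F K (c₀ F.L)).symm y ⟨z, κ⟩) μ ν x) j k‖ ^ 2 else 0) ∧
              As ≤ ∑ c ∈ Finset.univ.filter (fun c : PBond (F.P K) (K - n) => ∀ κ : Fin 3,
                  min ((c.src) κ - ((g κ * F.L ^ s : ℕ) : ZMod ((F.P K).sitesPerDir (K - n)))).val
                    ((((g κ * F.L ^ s : ℕ) : ZMod ((F.P K).sitesPerDir (K - n)))) - (c.src) κ).val ≤ 2 * F.L ^ s + 2),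
                (c₀ F.L / cB F.L) * ((F.L : ℝ) ^ (K - n)) ^ 3 * (cB F.L * ‖WL2.equiv ℂ (fun _ : PBond (F.P n) 0 => cB F.L) W₂
                  (Qkc F n K hnK.le (c₀ F.L) (cB F.L) W y) ((bondShift (sites_eq F n K hnK.le)).symm c)‖ ^ 2))
    :
    ∀ (L : ℕ), 1 < L → ∃ ν cL cMR cHM : ℝ, 0 ≤ ν ∧ 0 ≤ cL ∧ 0 ≤ cMR ∧ 0 ≤ cHM ∧ ∃ s₀ : ℕ, ∀ s : ℕ, s₀ ≤ s → ∃ cΦ cρCu cρN cKCu cKN cMAs cMCu cMe cHCu cHN eP : ℝ, 0 ≤ cΦ ∧ 0 ≤ cρCu ∧ 0 ≤ cρN ∧ 0 ≤ cKCu ∧ 0 ≤ cKN ∧ 0 ≤ cMAs ∧ 0 ≤ cMCu ∧ 0 ≤ cMe ∧ 0 ≤ cHCu ∧ 0 ≤ cHN ∧ 0 < eP ∧ ∀ (F : T3Family), F.L = L → ∀ (n K : ℕ) (hnK : n < K) (e : ℝ) (W : GaugeField (F.P K) 0 (Matrix.specialUnitaryGroup (Fin 2) ℂ)), s < F.m +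 n → 0 < e → e ≤ eP → RegPr F n K e W → ∀ y : BondL2K ℂ 3 (periodsT3 F K) (c₀ F.L) W₂, ∃ (Z : Site (F.P K) 0 → SiteL2K ℂ 3 (periodsT3 F K) (c₀ F.L) W₂ →ₗ[ℂ] SiteL2K ℂ 3 (periodsT3 F K) (c₀ F.L) W₂) (ZE : Site (F.P K) 0 → BondL2K ℂ 3 (periodsT3 F K) (c₀ F.L) W₂ →ₗ[ℂ] BondL2K ℂ 3 (periodsT3 F K) (c₀ F.L) W₂) (φ κs : Site (F.P K) 0 → SiteL2K ℂ 3 (periodsT3 F K) (c₀ F.L) W₂) (r : Site (F.P K) 0 → BondL2K ℂ 3 (periodsT3 F K) (c₀ F.L) W₂) (Ni Cui Asi ρi Φi Ki Li Mi Hρi HMi : Site (F.P K) 0 → ℝ), (∀ v, ∑ i, Z i v = v) ∧ (∀ f, ∑ i, ZE i f = f) ∧ (∀ i, Z i (DstarL2 F n K (c₀ F.L) W y) = Z i (covLapSite F n K (c₀ F.L) W (φ i)) + Z i (κs i)) ∧ (∀ i, ZE i (DL2 F n K (c₀ F.L) W (φ i)) = ZE i y - ZE i (r i)) ∧ (∀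 i, Φi i ≤ cΦ * ((F.L : ℝ) ^ s) ^ 2 * Ni i) ∧ (∀ i, ρi i ≤ cρCu * Cui i + cρN * e * Ni i) ∧ (∀ i, Ki i ≤ cKCu * Cui i + cKN * e * Ni i) ∧ (∀ i, Li i ≤ cL * ((F.L : ℝ) ^ s)⁻¹ ^ 2 * Ni i) ∧ (∀ i, Mi i ≤ cMAs * Asi i + cMCu * Cui i + (cMR * ((F.L : ℝ) ^ s)⁻¹ ^ 2 + cMe * e) * Ni i) ∧ (∀ i, Hρi i ≤ cHCu * Cui i + cHN * e * Ni i) ∧ (∀ i, HMi i ≤ cHM * ((F.L : ℝ) ^ s)⁻¹ ^ 2 * Ni i) ∧ (∑ i, Ni i ≤ ν * ‖y‖ ^ 2) ∧ (∑ i, Cui i ≤ ν * (RCLike.re ⟪y, DeltaEtaSlot F n K (c₀ F.L) W y⟫_ℂ + 1029 * e * ‖y‖ ^ 2)) ∧ (∑ i, Asi i ≤ ν * ((c₀ F.L / cB F.L) * ((F.L : ℝ) ^ (K - n)) ^ 3 * ‖Qkc F n K hnK.le (c₀ F.L) (cB F.L) W y‖ ^ 2)) ∧ (‖∑ i, ZE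 i (r i)‖ ^ 2 ≤ ν * ∑ i, ρi i) ∧ (‖∑ i, (DL2 F n K (c₀ F.L) W (Z i (φ i)) - ZE i (DL2 F n K (c₀ F.L) W (φ i)))‖ ^ 2 ≤ ν * ∑ i, Mi i) ∧ ((fun (F : T3Family) (n K : ℕ) (W : GaugeField (F.P K) 0 (Matrix.specialUnitaryGroup (Fin 2) ℂ)) (f : BondL2K ℂ 3 (periodsT3 F K) (c₀ F.L) W₂) => c₀ F.L * ((F.L : ℝ) ^ (K - n)) ^ 2 * (∑ x : Site (F.P K) 0, ∑ μ : Fin (F.P K).d, ∑ ν : Fin (F.P K).d, (if μ < ν then ∑ j : Fin 2, ∑ k : Fin 2, ‖(curl (torusT (F.P K) 0) (fun κ z => unitsField (toUField W) ⟨z, κ⟩) (fun κ z => (toL2 F K (c₀ F.L)).symm f ⟨z, κ⟩) μ ν x) j k‖ ^ 2 else 0)) + ‖DstarL2 F n K (c₀ F.L) W f‖ ^ 2) F n K W (∑ i, ZE i (r i)) ≤ ν * ∑ i, Hρi i) ∧ ((fun (F : T3Family) (n K : ℕ) (W : GaugeField (F.P K) 0 (Matrix.specialUnitaryGroup (Fin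 2) ℂ)) (f : BondL2K ℂ 3 (periodsT3 F K) (c₀ F.L) W₂) => c₀ F.L * ((F.L : ℝ) ^ (K - n)) ^ 2 * (∑ x : Site (F.P K) 0, ∑ μ : Fin (F.P K).d, ∑ ν : Fin (F.P K).d, (if μ < ν then ∑ j : Fin 2, ∑ k : Fin 2, ‖(curl (torusT (F.P K) 0) (fun κ z => unitsField (toUField W) ⟨z, κ⟩) (fun κ z => (toL2 F K (c₀ F.L)).symm f ⟨z, κ⟩) μ ν x) j k‖ ^ 2 else 0)) + ‖DstarL2 F n K (c₀ F.L) W f‖ ^ 2) F n K W (∑ i, (DL2 F n K (c₀ F.L) W (Z i (φ i)) - ZE i (DL2 F n K (c₀ F.L) W (φ i)))) ≤ ν * ∑ i, HMi i) ∧ (‖∑ i, (covLapSite F n K (c₀ F.L) W (Z i (φ i)) - Z i (covLapSite F n K (c₀ F.L) W (φ i)))‖ ^ 2 ≤ ν * ∑ i, Li i) ∧ (‖∑ i, Z i (κs i)‖ ^ 2 ≤ ν * ∑ i, Ki i) ∧ (‖∑ i, Z i (φ i)‖ ^ 2 ≤ ν * ∑ i, Φi i) := by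
  intro L hL
  obtain ⟨cL, cMR, cHM, hcL, hcMR, hcHM, s₀, hs⟩ := hP1 L hL
  refine ⟨729, cL, cMR, cHM, by norm_num, hcL, hcMR, hcHM, s₀, fun s hs₀ => ?_⟩
  obtain ⟨cΦ, cρCu, cρN, cKCu, cKN, cMAs, cMCu, cMe, cHCu, cHN, eP,
    hcΦ, hcρCu, hcρN, hcKCu, hcKN, hcMAs, hcMCu, hcMe, hcHCu, hcHN, heP, hmem⟩ := hs s hs₀
  refine ⟨cΦ, cρCu, cρN, cKCu, cKN, cMAs, cMCu, cMe, cHCu, cHN, eP,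
    hcΦ, hcρCu, hcρN, hcKCu, hcKN, hcMAs, hcMCu, hcMe, hcHCu, hcHN, heP, ?_⟩
  intro F hF n K hnK e W hsm he heP' hreg y
  subst hF
  classical
  have hc0 : 0 < c₀ F.L := (hc₀ F.L).out
  have hcB0 : 0 < cB F.L := (hcB F.L).out
  have hL0 : (0 : ℝ) < F.L := by have := F.hL.2; exact_mod_cast (by omega : 0 < F.L)
  -- (1) the grid package of cutoffs (px11 ✓`exists_cutoffPackage` with the centre set displayed, px4 ✓p718711); the centre set is named `Zc` ONCE
  --     (an `obtain … rfl` letter: the closed grid term is never re-elaborated below — re-elaborating it inside a term that also consumes a membership proof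
  --     leaves a postponed `Fin 3`∕`Fin (F.P K).d` unification inside the `Finset.image` lambda and the defeq check then unfolds `Finset.image` without end)
  obtain ⟨ζ, Zs, Zb, h01, -, hoff, hsupp, hcard, hstep, hsec, hZs, hZb, hZ1s, hZ1b, -, -⟩ :=
    exists_cutoffPackage_grid (F := F) (n := n) (K := K) (c₀ := c₀ F.L) (W := W) s hnK hsm
  obtain ⟨Zc, hZc⟩ : ∃ Zc : Finset (Site (F.P K) 0), Zc = (((Fintype.piFinset fun _ : Fin 3 => Finset.range (2 * F.L ^ (F.m + n - s)))).image
          (fun g κ => ((g κ * (F.L ^ s * F.L ^ (K - n)) : ℕ) : ZMod ((F.P K).sitesPerDir 0))) : Finset (Site (F.P K) 0)) := ⟨_, rfl⟩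
  rw [← hZc] at hoff hcard
  -- (2) centres ↔ grid points (px4 ✓`corner_injOn`)
  have hex : ∀ c ∈ Zc, ∃ g, g ∈ (Fintype.piFinset fun _ : Fin 3 => Finset.range (2 * F.L ^ (F.m + n - s))) ∧
      ((fun g κ => ((g κ * (F.L ^ s * F.L ^ (K - n)) : ℕ) : ZMod ((F.P K).sitesPerDir 0))) : (Fin 3 → ℕ) → Site (F.P K) 0) g = c := by
    intro c hc
    rw [hZc] at hc
    exact Finset.mem_image.1 hc
  choose gOf hgOf_mem hgOf_eq using hex
  have hmemc : ∀ g ∈ (Fintype.piFinset fun _ : Fin 3 => Finset.range (2 * F.L ^ (F.m + n - s))),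
      ((fun g κ => ((g κ * (F.L ^ s * F.L ^ (K - n)) : ℕ) : ZMod ((F.P K).sitesPerDir 0))) : (Fin 3 → ℕ) → Site (F.P K) 0) g ∈ Zc := by
    intro g hg
    rw [hZc]
    exact Finset.mem_image_of_mem _ hg
  have hginv : ∀ g ∈ (Fintype.piFinset fun _ : Fin 3 => Finset.range (2 * F.L ^ (F.m + n - s))), ∀ h : _ ∈ Zc, gOf (((fun g κ => ((g κ * (F.L ^ s * F.L ^ (K - n)) : ℕ) : ZMod ((F.P K).sitesPerDir 0))) : (Fin 3 → ℕ) → Site (F.P K) 0) g) h = g :=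
    fun g hg h => corner_injOn F n K s hnK.le hsm.le (hgOf_mem _ h) hg (hgOf_eq _ h)
  -- (3) the per-patch schema at every centre, read through the package's rows there
  have hsupp' : ∀ c hc (x : Site (F.P K) 0), ζ c x ≠ 0 → ∀ κ : Fin 3,
      min (x κ - ((gOf c hc κ * (F.L ^ s * F.L ^ (K - n)) : ℕ) : ZMod ((F.P K).sitesPerDir 0))).val
        ((((gOf c hc κ * (F.L ^ s * F.L ^ (K - n)) : ℕ) : ZMod ((F.P K).sitesPerDir 0))) - x κ).val < F.L ^ s * F.L ^ (K - n) := by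
    intro c hc x hx κ
    have hcκ : c κ = ((gOf c hc κ * (F.L ^ s * F.L ^ (K - n)) : ℕ) : ZMod ((F.P K).sitesPerDir 0)) := by
      have h := congrFun (hgOf_eq c hc) κ
      exact h.symm
    rw [← hcκ]
    exact hsupp c x hx κ
  have hP := fun c hc =>
    hmem F rfl n K hnK e W hsm he heP' hreg y (gOf c hc) (hgOf_mem c hc) (ζ c) (Zs c) (Zb c) (h01 c) (hsupp' c hc)
      (hstep c) (hsec c) (hZs c) (hZb c)
  choose φc κsc rc Nc Cuc Asc hlocc hDφc hΦc hρc hKc hLc hMc hHρc hHMc hNc hCuc hAsc using hP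
  -- (4) the cutoffs vanish off the centre set
  have hZs0 : ∀ c, c ∉ Zc → ∀ v : SiteL2K ℂ 3 (periodsT3 F K) (c₀ F.L) W₂, Zs c v = 0 := by
    intro c hc v
    apply (toL2S F K (c₀ F.L)).symm.injective
    funext x
    rw [hZs, hoff c hc x, zero_smul, map_zero]
    rfl
  have hZb0 : ∀ c, c ∉ Zc → ∀ f : BondL2K ℂ 3 (periodsT3 F K) (c₀ F.L) W₂, Zb c f = 0 := by
    intro c hc f
    apply (toL2 F K (c₀ F.L)).symm.injective
    funext b
    rw [hZb, hoff c hc b.src, zero_smul, map_zero]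
    rfl
  -- the local energy of the zero form vanishes (the empty family of ✓`localEnergy_sum_le_of_overlap`)
  have hH0 : (c₀ F.L * ((F.L : ℝ) ^ (K - n)) ^ 2 * (∑ x : Site (F.P K) 0, ∑ μ : Fin (F.P K).d, ∑ ν : Fin (F.P K).d, (if μ < ν then ∑ j : Fin 2, ∑ k : Fin 2, ‖(curl (torusT (F.P K) 0) (fun κ z => unitsField (toUField W) ⟨z, κ⟩) (fun κ z => (toL2 F K (c₀ F.L)).symm ((0 : BondL2K ℂ 3 (periodsT3 F K) (c₀ F.L) W₂)) ⟨z, κ⟩) μ ν x) j k‖ ^ 2 else 0)) + ‖DstarL2 F n K (c₀ F.L) W ((0 : BondL2K ℂ 3 (periodsT3 F K) (c₀ F.L) W₂))‖ ^ 2) ≤ 0 := by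
    have h := localEnergy_sum_le_of_overlap F n K (c₀ F.L) W (∅ : Finset Unit) (fun _ => (0 : BondL2K ℂ 3 (periodsT3 F K) (c₀ F.L) W₂)) (fun _ => ∅) 0
      (by intro c b hb; simp at hb) (by intro x; simp)
    simpa using h
  -- (5) the per-centre data, zero off the centre set, and the nine per-patch rows at every index
  let φ : Site (F.P K) 0 → SiteL2K ℂ 3 (periodsT3 F K) (c₀ F.L) W₂ := fun c => if hc : c ∈ Zc then φc c hc else 0
  let κs : Site (F.P K) 0 → SiteL2K ℂ 3 (periodsT3 F K) (c₀ F.L) W₂ := fun c => if hc : c ∈ Zc then κsc c hc else 0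
  let r : Site (F.P K) 0 → BondL2K ℂ 3 (periodsT3 F K) (c₀ F.L) W₂ := fun c => if hc : c ∈ Zc then rc c hc else 0
  let Ni : Site (F.P K) 0 → ℝ := fun c => if hc : c ∈ Zc then Nc c hc else 0
  let Cui : Site (F.P K) 0 → ℝ := fun c => if hc : c ∈ Zc then Cuc c hc else 0
  let Asi : Site (F.P K) 0 → ℝ := fun c => if hc : c ∈ Zc then Asc c hc else 0
  have hrow : ∀ c : Site (F.P K) 0,
      (Zs c (DstarL2 F n K (c₀ F.L) W y) = Zs c (covLapSite F n K (c₀ F.L) W (φ c)) + Zs c (κs c)) ∧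
      (Zb c (DL2 F n K (c₀ F.L) W (φ c)) = Zb c y - Zb c (r c)) ∧
      (‖φ c‖ ^ 2 ≤ cΦ * ((F.L : ℝ) ^ s) ^ 2 * Ni c) ∧
      (‖r c‖ ^ 2 ≤ cρCu * Cui c + cρN * e * Ni c) ∧
      (‖Zs c (κs c)‖ ^ 2 ≤ cKCu * Cui c + cKN * e * Ni c) ∧
      (‖covLapSite F n K (c₀ F.L) W (Zs c (φ c)) - Zs c (covLapSite F n K (c₀ F.L) W (φ c))‖ ^ 2 ≤ cL * ((F.L : ℝ) ^ s)⁻¹ ^ 2 * Ni c) ∧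
      (‖DL2 F n K (c₀ F.L) W (Zs c (φ c)) - Zb c (DL2 F n K (c₀ F.L) W (φ c))‖ ^ 2
          ≤ cMAs * Asi c + cMCu * Cui c + (cMR * ((F.L : ℝ) ^ s)⁻¹ ^ 2 + cMe * e) * Ni c) ∧
      ((c₀ F.L * ((F.L : ℝ) ^ (K - n)) ^ 2 * (∑ x : Site (F.P K) 0, ∑ μ : Fin (F.P K).d, ∑ ν : Fin (F.P K).d, (if μ < ν then ∑ j : Fin 2, ∑ k : Fin 2, ‖(curl (torusT (F.P K) 0) (fun κ z => unitsField (toUField W) ⟨z, κ⟩) (fun κ z => (toL2 F K (c₀ F.L)).symm (Zb c (r c)) ⟨z, κ⟩) μ ν x) j k‖ ^ 2 else 0)) + ‖DstarL2 F n K (c₀ F.L) W (Zb c (r c))‖ ^ 2)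
          ≤ cHCu * Cui c + cHN * e * Ni c) ∧
      ((c₀ F.L * ((F.L : ℝ) ^ (K - n)) ^ 2 * (∑ x : Site (F.P K) 0, ∑ μ : Fin (F.P K).d, ∑ ν : Fin (F.P K).d, (if μ < ν then ∑ j : Fin 2, ∑ k : Fin 2, ‖(curl (torusT (F.P K) 0) (fun κ z => unitsField (toUField W) ⟨z, κ⟩) (fun κ z => (toL2 F K (c₀ F.L)).symm (DL2 F n K (c₀ F.L) W (Zs c (φ c)) - Zb c (DL2 F n K (c₀ F.L) W (φ c))) ⟨z, κ⟩) μ ν x) j k‖ ^ 2 else 0)) + ‖DstarL2 F n K (c₀ F.L) W (DL2 F n K (c₀ F.L) W (Zs c (φ c)) - Zb c (DL2 F n K (c₀ F.L) W (φ c)))‖ ^ 2)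
          ≤ cHM * ((F.L : ℝ) ^ s)⁻¹ ^ 2 * Ni c) := by
    intro c
    by_cases hc : c ∈ Zc
    · have e1 : φ c = φc c hc := dif_pos hc
      have e2 : κs c = κsc c hc := dif_pos hc
      have e3 : r c = rc c hc := dif_pos hc
      have e4 : Ni c = Nc c hc := dif_pos hc
      have e5 : Cui c = Cuc c hc := dif_pos hc
      have e6 : Asi c = Asc c hc := dif_pos hc
      rw [e1, e2, e3, e4, e5, e6]
      exact ⟨hlocc c hc, hDφc c hc, hΦc c hc, hρc c hc, hKc c hc, hLc c hc, hMc c hc, hHρc c hc, hHMc c hc⟩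
    · have e1 : φ c = 0 := dif_neg hc
      have e2 : κs c = 0 := dif_neg hc
      have e3 : r c = 0 := dif_neg hc
      have e4 : Ni c = 0 := dif_neg hc
      have e5 : Cui c = 0 := dif_neg hc
      have e6 : Asi c = 0 := dif_neg hc
      rw [e1, e2, e3, e4, e5, e6]
      have hD0 : DL2 F n K (c₀ F.L) W (0 : SiteL2K ℂ 3 (periodsT3 F K) (c₀ F.L) W₂) = 0 := map_zero _
      have hL0 : covLapSite F n K (c₀ F.L) W (0 : SiteL2K ℂ 3 (periodsT3 F K) (c₀ F.L) W₂) = 0 := map_zero _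
      simp only [hZs0 c hc, hZb0 c hc]
      refine ⟨(add_zero _).symm, (sub_zero _).symm, ?_, ?_, ?_, ?_, ?_, ?_, ?_⟩
      · rw [norm_zero]; norm_num
      · rw [norm_zero]; norm_num
      · rw [norm_zero]; norm_num
      · rw [hL0, sub_zero, norm_zero]; norm_num
      · rw [hD0, sub_zero, norm_zero]; norm_num
      · rw [mul_zero, mul_zero, add_zero]; exact hH0
      · rw [hD0, sub_zero, mul_zero]; exact hH0
  -- (6) the three resource rows over the grid (px9 counting through px4 ✓p720519)
  have hwN : ∀ b : PBond (F.P K) 0, 0 ≤ c₀ F.L * ‖(frobEquiv.symm ((toL2 F K (c₀ F.L)).symm y b) : W₂)‖ ^ 2 := fun b => by positivity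
  have hwC : ∀ x : Site (F.P K) 0, 0 ≤ c₀ F.L * ((F.L : ℝ) ^ (K - n)) ^ 2 * ∑ μ : Fin (F.P K).d, ∑ ν : Fin (F.P K).d, (if μ < ν then ∑ j : Fin 2, ∑ k : Fin 2,
          ‖(curl (torusT (F.P K) 0) (fun κ z => unitsField (toUField W) ⟨z, κ⟩) (fun κ z => (toL2 F K (c₀ F.L)).symm y ⟨z, κ⟩) μ ν x) j k‖ ^ 2 else 0) :=
    fun x => mul_nonneg (by positivity) (Finset.sum_nonneg fun μ _ => Finset.sum_nonneg fun ν _ => by split_ifs <;> positivity)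
  have hwA : ∀ c : PBond (F.P K) (K - n), 0 ≤ (c₀ F.L / cB F.L) * ((F.L : ℝ) ^ (K - n)) ^ 3 * (cB F.L * ‖WL2.equiv ℂ (fun _ : PBond (F.P n) 0 => cB F.L) W₂
          (Qkc F n K hnK.le (c₀ F.L) (cB F.L) W y) ((bondShift (sites_eq F n K hnK.le)).symm c)‖ ^ 2) := fun c => by positivity
  have hNoff : ∀ c, c ∉ (((Fintype.piFinset fun _ : Fin 3 => Finset.range (2 * F.L ^ (F.m + n - s)))).image
          (fun g κ => ((g κ * (F.L ^ s * F.L ^ (K - n)) : ℕ) : ZMod ((F.P K).sitesPerDir 0))) : Finset (Site (F.P K) 0)) → Ni c = 0 :=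
    fun c hc => dif_neg (by rw [hZc]; exact hc)
  have hCuoff : ∀ c, c ∉ (((Fintype.piFinset fun _ : Fin 3 => Finset.range (2 * F.L ^ (F.m + n - s)))).image
          (fun g κ => ((g κ * (F.L ^ s * F.L ^ (K - n)) : ℕ) : ZMod ((F.P K).sitesPerDir 0))) : Finset (Site (F.P K) 0)) → Cui c = 0 :=
    fun c hc => dif_neg (by rw [hZc]; exact hc)
  have hAsoff : ∀ c, c ∉ (((Fintype.piFinset fun _ : Fin 3 => Finset.range (2 * F.L ^ (F.m + n - s)))).image
          (fun g κ => ((g κ * (F.L ^ s * F.L ^ (K - n)) : ℕ) : ZMod ((F.P K).sitesPerDir 0))) : Finset (Site (F.P K) 0)) → Asi c = 0 :=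
    fun c hc => dif_neg (by rw [hZc]; exact hc)
  have hresN : ∑ c, Ni c ≤ 729 * ‖y‖ ^ 2 := by
    have h := sum_le_729_mul_sum_of_patch_bonds F n K s hnK.le hsm.le Ni (fun b => c₀ F.L * ‖(frobEquiv.symm ((toL2 F K (c₀ F.L)).symm y b) : W₂)‖ ^ 2) hwN hNoff
      (fun g hg => by
        have hm := hmemc g hg
        have e4 : Ni (((fun g κ => ((g κ * (F.L ^ s * F.L ^ (K - n)) : ℕ) : ZMod ((F.P K).sitesPerDir 0))) : (Fin 3 → ℕ) → Site (F.P K) 0) g) = Nc _ hm := dif_pos hm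
        have h := hNc _ hm
        rw [hginv g hg hm] at h
        rw [e4]
        exact h)
    have hy : ∑ b : PBond (F.P K) 0, c₀ F.L * ‖(frobEquiv.symm ((toL2 F K (c₀ F.L)).symm y b) : W₂)‖ ^ 2 = ‖y‖ ^ 2 := by
      rw [← Finset.mul_sum, ← norm_toL2_sq (F := F) (K := K) (c₀ := c₀ F.L), LinearEquiv.apply_symm_apply]
    rw [hy] at h
    exact h
  have hresC : ∑ c, Cui c ≤ 729 * (RCLike.re ⟪y, DeltaEtaSlot F n K (c₀ F.L) W y⟫_ℂ + 1029 * e * ‖y‖ ^ 2) := by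
    have h := sum_le_mul_sum_of_patch_sites F n K s hnK.le hsm.le (2 * F.L ^ s + 2) Cui (fun x => c₀ F.L * ((F.L : ℝ) ^ (K - n)) ^ 2 * ∑ μ : Fin (F.P K).d, ∑ ν : Fin (F.P K).d, (if μ < ν then ∑ j : Fin 2, ∑ k : Fin 2,
          ‖(curl (torusT (F.P K) 0) (fun κ z => unitsField (toUField W) ⟨z, κ⟩) (fun κ z => (toL2 F K (c₀ F.L)).symm y ⟨z, κ⟩) μ ν x) j k‖ ^ 2 else 0)) hwC hCuoff
      (fun g hg => by
        have hm := hmemc g hg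
        have e5 : Cui (((fun g κ => ((g κ * (F.L ^ s * F.L ^ (K - n)) : ℕ) : ZMod ((F.P K).sitesPerDir 0))) : (Fin 3 → ℕ) → Site (F.P K) 0) g) = Cuc _ hm := dif_pos hm
        have h := hCuc _ hm
        rw [hginv g hg hm] at h
        rw [e5]
        exact h)
    have hmult : (((2 * ((2 * F.L ^ s + 2 + F.L ^ s - 1) / F.L ^ s) + 1) ^ 3 : ℕ) : ℝ) ≤ 729 := by
      exact_mod_cast multiplicity_le_729 F s
    have hS0 : 0 ≤ ∑ x : Site (F.P K) 0, c₀ F.L * ((F.L : ℝ) ^ (K - n)) ^ 2 * ∑ μ : Fin (F.P K).d, ∑ ν : Fin (F.P K).d, (if μ < ν then ∑ j : Fin 2, ∑ k : Fin 2,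
          ‖(curl (torusT (F.P K) 0) (fun κ z => unitsField (toUField W) ⟨z, κ⟩) (fun κ z => (toL2 F K (c₀ F.L)).symm y ⟨z, κ⟩) μ ν x) j k‖ ^ 2 else 0) := Finset.sum_nonneg fun x _ => hwC x
    have hcurl : ∑ x : Site (F.P K) 0, c₀ F.L * ((F.L : ℝ) ^ (K - n)) ^ 2 * ∑ μ : Fin (F.P K).d, ∑ ν : Fin (F.P K).d, (if μ < ν then ∑ j : Fin 2, ∑ k : Fin 2,
          ‖(curl (torusT (F.P K) 0) (fun κ z => unitsField (toUField W) ⟨z, κ⟩) (fun κ z => (toL2 F K (c₀ F.L)).symm y ⟨z, κ⟩) μ ν x) j k‖ ^ 2 else 0)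
        ≤ RCLike.re ⟪y, DeltaEtaSlot F n K (c₀ F.L) W y⟫_ℂ + 1029 * e * ‖y‖ ^ 2 := by
      have hc := curlHS_le_re_inner_DeltaEtaSlot (F := F) (n := n) (K := K) (c₀ := c₀ F.L) he.le W hreg ((toL2 F K (c₀ F.L)).symm y)
      rw [LinearEquiv.apply_symm_apply] at hc
      rw [← Finset.mul_sum]
      exact hc
    calc ∑ c, Cui c ≤ _ := h
      _ ≤ 729 * ∑ x : Site (F.P K) 0, c₀ F.L * ((F.L : ℝ) ^ (K - n)) ^ 2 * ∑ μ : Fin (F.P K).d, ∑ ν : Fin (F.P K).d, (if μ < ν then ∑ j : Fin 2, ∑ k : Fin 2,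
          ‖(curl (torusT (F.P K) 0) (fun κ z => unitsField (toUField W) ⟨z, κ⟩) (fun κ z => (toL2 F K (c₀ F.L)).symm y ⟨z, κ⟩) μ ν x) j k‖ ^ 2 else 0) := mul_le_mul_of_nonneg_right hmult hS0
      _ ≤ _ := mul_le_mul_of_nonneg_left hcurl (by norm_num)
  have hresA : ∑ c, Asi c ≤ 729 * ((c₀ F.L / cB F.L) * ((F.L : ℝ) ^ (K - n)) ^ 3 * ‖Qkc F n K hnK.le (c₀ F.L) (cB F.L) W y‖ ^ 2) := by
    have h := sum_le_mul_sum_of_patch_coarseBonds F n K s hnK.le hsm.le (2 * F.L ^ s + 2) Asi (fun c => (c₀ F.L / cB F.L) * ((F.L : ℝ) ^ (K - n)) ^ 3 * (cB F.L * ‖WL2.equiv ℂ (fun _ : PBond (F.P n) 0 => cB F.L) W₂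
          (Qkc F n K hnK.le (c₀ F.L) (cB F.L) W y) ((bondShift (sites_eq F n K hnK.le)).symm c)‖ ^ 2)) hwA hAsoff
      (fun g hg => by
        have hm := hmemc g hg
        have e6 : Asi (((fun g κ => ((g κ * (F.L ^ s * F.L ^ (K - n)) : ℕ) : ZMod ((F.P K).sitesPerDir 0))) : (Fin 3 → ℕ) → Site (F.P K) 0) g) = Asc _ hm := dif_pos hm
        have h := hAsc _ hm
        rw [hginv g hg hm] at h
        rw [e6]
        exact h)
    have hmult : (((2 * ((2 * F.L ^ s + 2 + F.L ^ s - 1) / F.L ^ s) + 1) ^ 3 : ℕ) : ℝ) ≤ 729 := by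
      exact_mod_cast multiplicity_le_729 F s
    have hS0 : 0 ≤ ∑ c : PBond (F.P K) (K - n), (c₀ F.L / cB F.L) * ((F.L : ℝ) ^ (K - n)) ^ 3 * (cB F.L * ‖WL2.equiv ℂ (fun _ : PBond (F.P n) 0 => cB F.L) W₂
          (Qkc F n K hnK.le (c₀ F.L) (cB F.L) W y) ((bondShift (sites_eq F n K hnK.le)).symm c)‖ ^ 2) := Finset.sum_nonneg fun c _ => hwA c
    have hfib : ∑ c : PBond (F.P K) (K - n), (c₀ F.L / cB F.L) * ((F.L : ℝ) ^ (K - n)) ^ 3 * (cB F.L * ‖WL2.equiv ℂ (fun _ : PBond (F.P n) 0 => cB F.L) W₂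
          (Qkc F n K hnK.le (c₀ F.L) (cB F.L) W y) ((bondShift (sites_eq F n K hnK.le)).symm c)‖ ^ 2)
        ≤ (c₀ F.L / cB F.L) * ((F.L : ℝ) ^ (K - n)) ^ 3 * ‖Qkc F n K hnK.le (c₀ F.L) (cB F.L) W y‖ ^ 2 := by
      rw [← Finset.mul_sum, ← Finset.mul_sum]
      exact mul_le_mul_of_nonneg_left (sum_fibre_sq_le_norm_sq F n K hnK.le (cB := cB F.L) Finset.univ _) (by positivity)
    calc ∑ c, Asi c ≤ _ := h
      _ ≤ 729 * ∑ c : PBond (F.P K) (K - n), (c₀ F.L / cB F.L) * ((F.L : ℝ) ^ (K - n)) ^ 3 * (cB F.L * ‖WL2.equiv ℂ (fun _ : PBond (F.P n) 0 => cB F.L) W₂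
          (Qkc F n K hnK.le (c₀ F.L) (cB F.L) W y) ((bondShift (sites_eq F n K hnK.le)).symm c)‖ ^ 2) := mul_le_mul_of_nonneg_right hmult hS0
      _ ≤ _ := mul_le_mul_of_nonneg_left hfib (by norm_num)
  -- (7) the seven family rows ((FAM) ✓p720883), letters = the canonical per-patch quantities, ν := 729 ≥ 392
  obtain ⟨hSr, hSM, hSHr, hSHM, hSL, hSK, hSΦ⟩ := family_rows n (c₀ F.L) ζ Zc Zs Zb W hoff hcard hZs hZb φ κs r
    (fun i => ‖r i‖ ^ 2) (fun i => ‖DL2 F n K (c₀ F.L) W (Zs i (φ i)) - Zb i (DL2 F n K (c₀ F.L) W (φ i))‖ ^ 2)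
    (fun i => (c₀ F.L * ((F.L : ℝ) ^ (K - n)) ^ 2 * (∑ x : Site (F.P K) 0, ∑ μ : Fin (F.P K).d, ∑ ν : Fin (F.P K).d, (if μ < ν then ∑ j : Fin 2, ∑ k : Fin 2, ‖(curl (torusT (F.P K) 0) (fun κ z => unitsField (toUField W) ⟨z, κ⟩) (fun κ z => (toL2 F K (c₀ F.L)).symm (Zb i (r i)) ⟨z, κ⟩) μ ν x) j k‖ ^ 2 else 0)) + ‖DstarL2 F n K (c₀ F.L) W (Zb i (r i))‖ ^ 2))
    (fun i => (c₀ F.L * ((F.L : ℝ) ^ (K - n)) ^ 2 * (∑ x : Site (F.P K) 0, ∑ μ : Fin (F.P K).d, ∑ ν : Fin (F.P K).d, (if μ < ν then ∑ j : Fin 2, ∑ k : Fin 2, ‖(curl (torusT (F.P K) 0) (fun κ z => unitsField (toUField W) ⟨z, κ⟩) (fun κ z => (toL2 F K (c₀ F.L)).symm (DL2 F n K (c₀ F.L) W (Zs i (φ i)) - Zb i (DL2 F n K (c₀ F.L) W (φ i))) ⟨z, κ⟩) μ ν x) j k‖ ^ 2 else 0)) + ‖DstarL2 F n K (c₀ F.L)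 W (DL2 F n K (c₀ F.L) W (Zs i (φ i)) - Zb i (DL2 F n K (c₀ F.L) W (φ i)))‖ ^ 2))
    (fun i => ‖covLapSite F n K (c₀ F.L) W (Zs i (φ i)) - Zs i (covLapSite F n K (c₀ F.L) W (φ i))‖ ^ 2)
    (fun i => ‖Zs i (κs i)‖ ^ 2) (fun i => ‖φ i‖ ^ 2)
    (fun i => norm_sq_bondCutoff_le_norm_sq F K (c₀ F.L) (Zb i) (fun b => ζ i b.src) (hZb i) (fun b => h01 i b.src) (r i))
    (fun i => le_rfl) (fun i => le_rfl) (fun i => le_rfl) (fun i => le_rfl) (fun i => le_rfl)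
    (fun i => norm_sq_siteCutoff_le_norm_sq F K (c₀ F.L) (Zs i) (ζ i) (hZs i) (h01 i) (φ i))
    (by norm_num : (392 : ℝ) ≤ 729)
  -- (8) assemble
  exact ⟨Zs, Zb, φ, κs, r, Ni, Cui, Asi, fun i => ‖r i‖ ^ 2, fun i => ‖φ i‖ ^ 2, fun i => ‖Zs i (κs i)‖ ^ 2,
    fun i => ‖covLapSite F n K (c₀ F.L) W (Zs i (φ i)) - Zs i (covLapSite F n K (c₀ F.L) W (φ i))‖ ^ 2,
    fun i => ‖DL2 F n K (c₀ F.L) W (Zs i (φ i)) - Zb i (DL2 F n K (c₀ F.L) W (φ i))‖ ^ 2,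
    fun i => (c₀ F.L * ((F.L : ℝ) ^ (K - n)) ^ 2 * (∑ x : Site (F.P K) 0, ∑ μ : Fin (F.P K).d, ∑ ν : Fin (F.P K).d, (if μ < ν then ∑ j : Fin 2, ∑ k : Fin 2, ‖(curl (torusT (F.P K) 0) (fun κ z => unitsField (toUField W) ⟨z, κ⟩) (fun κ z => (toL2 F K (c₀ F.L)).symm (Zb i (r i)) ⟨z, κ⟩) μ ν x) j k‖ ^ 2 else 0)) + ‖DstarL2 F n K (c₀ F.L) W (Zb i (r i))‖ ^ 2),
    fun i => (c₀ F.L * ((F.L : ℝ) ^ (K - n)) ^ 2 * (∑ x : Site (F.P K) 0, ∑ μ : Fin (F.P K).d, ∑ ν : Fin (F.P K).d, (if μ < ν then ∑ j : Fin 2, ∑ k : Fin 2, ‖(curl (torusT (F.P K) 0) (fun κ z => unitsField (toUField W) ⟨z, κ⟩) (fun κ z => (toL2 F K (c₀ F.L)).symm (DL2 F n K (c₀ F.L) W (Zs i (φ i)) - Zb i (DL2 F n K (c₀ F.L) W (φ i))) ⟨z, κ⟩) μ ν x) j k‖ ^ 2 else 0)) + ‖DstarL2 F n K (c₀ F.L)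 W (DL2 F n K (c₀ F.L) W (Zs i (φ i)) - Zb i (DL2 F n K (c₀ F.L) W (φ i)))‖ ^ 2),
    hZ1s, hZ1b, fun i => (hrow i).1, fun i => (hrow i).2.1, fun i => (hrow i).2.2.1, fun i => (hrow i).2.2.2.1,
    fun i => (hrow i).2.2.2.2.1, fun i => (hrow i).2.2.2.2.2.1, fun i => (hrow i).2.2.2.2.2.2.1, fun i => (hrow i).2.2.2.2.2.2.2.1,
    fun i => (hrow i).2.2.2.2.2.2.2.2, hresN, hresC, hresA, hSr, hSM, hSHr, hSHM, hSL, hSK, hSΦ⟩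

end Summit.QuantumFields.YangMills.Theorems.Prop7DivRecoveryAssemblyPatches2

end
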